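import Mathlib
import HarnessLib

/-!
# Regular-value density — `stub_regularValueDensity` (stub REG), line `swap-odd-threshold-rigidity`
(crux `EmbeddedDrudeMourre.MourreDissolution`, item stmt-AtomisticToContinuum-12594; helper file,
`--supports`)

Registered stub REG (shape `REG-loc → REG`) of the checked skeleton of line
`swap-odd-threshold-rigidity`, in the skeleton's stub namespace.

* Hypothesis (`REG-loc`, the neighbouring stub, assumed verbatim): for `Ω ∈ C¹(ℝ × ℝ × ℝ)` with
  `∂Ω/∂x₁ ≥ c > 0` on a closed box and a continuous weight `G ≥ 0` supported in the open box, the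
  push-forward `Ω_* (G · vol)` has a continuous global density `ρ ≥ 0`.
* Conclusion (`REG`): for `Ω ∈ C¹`, `G ≥ 0` continuous with compact support and `dΩ ≠ 0` on
  `tsupport G ∩ {|Ω| ≤ δ₀}`, `Ω_* (G · vol)` has a continuous density `ρ ≥ 0` on `(-δ₀, δ₀)`.

Proof (general real analysis, Mathlib only).
1. *Localisation* (`regValue_local`). At `p` with `dΩ(p) ≠ 0` some partial `∂ᵢΩ(p) ≠ 0`
   (`regValue_exists_dir`); by continuity it keeps its sign and half its modulus on a closed ball
   (= closed box, sup metric). Transporting the coordinate `i` to the first one by a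
   volume-preserving coordinate swap (`regValue_measurePreserving_swap12/23`) and the sign by
   `Ω ↦ -Ω` (Lebesgue measure is even), `REG-loc` gives a ball `B(p, r)` on which every
   continuous `G' ≥ 0` supported in it has a continuous global density.
2. *Partition of unity.* `K = tsupport G ∩ Ω⁻¹[-δ₀, δ₀]` is compact, covered by finitely many such
   balls; `exists_continuous_sum_one_of_isOpen_isCompact` gives continuous `0 ≤ χⱼ ≤ 1`
   subordinate to them with `Σ χⱼ = 1` on `K`; each `χⱼ G` has a continuous global density `ρⱼ`.
3. *Summation* (`regValue_restrict_map_eq_sum`). `G = Σ χⱼ G` on `Ω⁻¹(-δ₀, δ₀)`, so on the window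
   the push-forward of `G · vol` has density `Σ ρⱼ` (a computation with set integrals).
-/

noncomputable section

namespace Summit.AtomisticToContinuum.FouriersLaw.Theorems.MourreDissolution

open MeasureTheory Set Metric
open scoped ENNReal Topology

/-! ### Transport of densities -/

/-- Transport of a density under a measure-preserving measurable automorphism `e`:
`e_* (f · μ) = g · μ` whenever `g ∘ e = f`. [folklore] -/
theorem regValue_map_withDensity_of_measurePreserving {α : Type*} [MeasurableSpace α]
    {μ : Measure α} (e : α ≃ᵐ α) (he : MeasurePreserving e μ μ) {f g : α → ℝ≥0∞}
    (hfg : ∀ x, g (e x) = f x) :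
    (μ.withDensity f).map e = μ.withDensity g := by
  ext s hs
  rw [e.map_apply, withDensity_apply _ (e.measurable hs), withDensity_apply _ hs,
    ← he.setLIntegral_comp_preimage_emb e.measurableEmbedding g s]
  simp_rw [hfg]

/-- Lebesgue measure on the line is even: `(-)_* (f · vol) = f(-·) · vol`. [folklore] -/
theorem regValue_map_neg_withDensity (f : ℝ → ℝ≥0∞) :
    (volume.withDensity f).map Neg.neg = volume.withDensity fun x => f (-x) :=
  regValue_map_withDensity_of_measurePreserving (MeasurableEquiv.neg ℝ)
    (Measure.measurePreserving_neg volume) fun _ => by simp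

/-- Stability of "the push-forward `Ω_* (G · vol)` has a continuous global density `≥ 0`" under
`Ω ↦ -Ω`. [folklore] -/
theorem regValue_hasDensity_of_neg {Ω G : ℝ × ℝ × ℝ → ℝ} (hΩm : Measurable Ω)
    (h : ∃ ρ : ℝ → ℝ, Continuous ρ ∧ (∀ x, 0 ≤ ρ x) ∧
      Measure.map (fun q => -Ω q) (volume.withDensity fun q => ENNReal.ofReal (G q)) =
        volume.withDensity fun x => ENNReal.ofReal (ρ x)) :
    ∃ ρ : ℝ → ℝ, Continuous ρ ∧ (∀ x, 0 ≤ ρ x) ∧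
      Measure.map Ω (volume.withDensity fun q => ENNReal.ofReal (G q)) =
        volume.withDensity fun x => ENNReal.ofReal (ρ x) := by
  obtain ⟨ρ, hρc, hρ0, hρ⟩ := h
  refine ⟨fun x => ρ (-x), hρc.comp continuous_neg, fun x => hρ0 _, ?_⟩
  have hcomp : (Neg.neg ∘ fun q => -Ω q) = Ω := funext fun q => neg_neg (Ω q)
  calc Measure.map Ω (volume.withDensity fun q => ENNReal.ofReal (G q))
      = Measure.map Neg.neg (Measure.map (fun q => -Ω q)
          (volume.withDensity fun q => ENNReal.ofReal (G q))) := by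
        rw [Measure.map_map measurable_neg hΩm.fun_neg, hcomp]
    _ = volume.withDensity fun x => ENNReal.ofReal (ρ (-x)) := by
        rw [hρ]; exact regValue_map_neg_withDensity _

/-- Stability of "the push-forward `Ω_* (G · vol)` has a continuous global density `≥ 0`" under a
volume-preserving continuous linear change of coordinates `e`. [folklore] -/
theorem regValue_hasDensity_of_equiv (e : (ℝ × ℝ × ℝ) ≃L[ℝ] (ℝ × ℝ × ℝ))
    (he : MeasurePreserving e volume volume) {Ω G : ℝ × ℝ × ℝ → ℝ} (hΩm : Measurable Ω)
    (h : ∃ ρ : ℝ → ℝ, Continuous ρ ∧ (∀ x, 0 ≤ ρ x) ∧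
      Measure.map (Ω ∘ e) (volume.withDensity fun q => ENNReal.ofReal ((G ∘ e) q)) =
        volume.withDensity fun x => ENNReal.ofReal (ρ x)) :
    ∃ ρ : ℝ → ℝ, Continuous ρ ∧ (∀ x, 0 ≤ ρ x) ∧
      Measure.map Ω (volume.withDensity fun q => ENNReal.ofReal (G q)) =
        volume.withDensity fun x => ENNReal.ofReal (ρ x) := by
  obtain ⟨ρ, hρc, hρ0, hρ⟩ := h
  refine ⟨ρ, hρc, hρ0, ?_⟩
  have he' : MeasurePreserving e.toHomeomorph.toMeasurableEquiv volume volume := he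
  have hmap : Measure.map e (volume.withDensity fun q => ENNReal.ofReal ((G ∘ e) q)) =
      volume.withDensity fun q => ENNReal.ofReal (G q) :=
    regValue_map_withDensity_of_measurePreserving e.toHomeomorph.toMeasurableEquiv he'
      fun _ => rfl
  rw [← hρ, ← Measure.map_map hΩm he.measurable, hmap]

/-! ### Coordinate swaps of `ℝ × ℝ × ℝ` -/

/-- The coordinate swap `(x, y, z) ↦ (y, x, z)` preserves Lebesgue measure (Fubini: it is
`prodAssoc ∘ (swap × id) ∘ prodAssoc⁻¹`). [folklore] -/
theorem regValue_measurePreserving_swap12 :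
    MeasurePreserving (fun q : ℝ × ℝ × ℝ => (q.2.1, q.1, q.2.2)) volume volume := by
  have h1 := measurePreserving_prodAssoc (volume : Measure ℝ) (volume : Measure ℝ)
    (volume : Measure ℝ)
  have h2 : MeasurePreserving (Prod.map Prod.swap id)
      (((volume : Measure ℝ).prod (volume : Measure ℝ)).prod (volume : Measure ℝ))
      (((volume : Measure ℝ).prod (volume : Measure ℝ)).prod (volume : Measure ℝ)) :=
    Measure.measurePreserving_swap.prod (MeasurePreserving.id _)
  have hfun : (fun q : ℝ × ℝ × ℝ => (q.2.1, q.1, q.2.2)) =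
      (MeasurableEquiv.prodAssoc : (ℝ × ℝ) × ℝ ≃ᵐ ℝ × ℝ × ℝ) ∘ Prod.map Prod.swap id ∘
        (MeasurableEquiv.prodAssoc : (ℝ × ℝ) × ℝ ≃ᵐ ℝ × ℝ × ℝ).symm := by
    funext q; rfl
  rw [hfun]
  exact h1.comp (h2.comp (h1.symm _))

/-- The coordinate swap `(x, y, z) ↦ (x, z, y) = id × swap` preserves Lebesgue measure.
[folklore] -/
theorem regValue_measurePreserving_swap23 :
    MeasurePreserving (fun q : ℝ × ℝ × ℝ => (q.1, q.2.2, q.2.1)) volume volume := by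
  have h : MeasurePreserving (Prod.map id Prod.swap)
      ((volume : Measure ℝ).prod ((volume : Measure ℝ).prod (volume : Measure ℝ)))
      ((volume : Measure ℝ).prod ((volume : Measure ℝ).prod (volume : Measure ℝ))) :=
    (MeasurePreserving.id _).prod Measure.measurePreserving_swap
  have hfun : (fun q : ℝ × ℝ × ℝ => (q.1, q.2.2, q.2.1)) = Prod.map id Prod.swap := by
    funext q; rfl
  rw [hfun]
  exact h

/-! ### Local analysis -/

/-- A nonzero linear form on `ℝ × ℝ × ℝ` is nonzero on one of the coordinate vectors. [folklore] -/
theorem regValue_exists_dir {L : ℝ × ℝ × ℝ →L[ℝ] ℝ} (hL : L ≠ 0) :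
    L (1, 0, 0) ≠ 0 ∨ L (0, 1, 0) ≠ 0 ∨ L (0, 0, 1) ≠ 0 := by
  by_contra h
  simp only [not_or, not_not] at h
  obtain ⟨h1, h2, h3⟩ := h
  apply hL
  refine ContinuousLinearMap.ext fun q => ?_
  obtain ⟨x, y, z⟩ := q
  have hxyz : ((x, y, z) : ℝ × ℝ × ℝ) = x • ((1, 0, 0) : ℝ × ℝ × ℝ) +
      y • ((0, 1, 0) : ℝ × ℝ × ℝ) + z • ((0, 0, 1) : ℝ × ℝ × ℝ) := by
    ext <;> simp
  rw [hxyz, map_add, map_add, map_smul, map_smul, map_smul, h1, h2, h3]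
  simp

/-- A continuous real function positive at `p` stays above half its value on a closed ball
around `p`. [folklore] -/
theorem regValue_ball_lower_bound {X : Type*} [PseudoMetricSpace X] {f : X → ℝ} {p : X}
    (hf : Continuous f) (hp : 0 < f p) : ∃ r > 0, ∀ q ∈ closedBall p r, f p / 2 ≤ f q := by
  have h : {q | f p / 2 < f q} ∈ 𝓝 p :=
    (isOpen_lt continuous_const hf).mem_nhds (show f p / 2 < f p by linarith)
  obtain ⟨r, hr0, hr⟩ := Metric.nhds_basis_closedBall.mem_iff.mp h
  exact ⟨r, hr0, fun q hq => le_of_lt (hr hq)⟩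

/-- Balls of `ℝ × ℝ × ℝ` (sup metric) are open boxes. [folklore] -/
theorem regValue_ball_eq (p₁ p₂ p₃ r : ℝ) :
    ball ((p₁, p₂, p₃) : ℝ × ℝ × ℝ) r =
      Ioo (p₁ - r) (p₁ + r) ×ˢ (Ioo (p₂ - r) (p₂ + r) ×ˢ Ioo (p₃ - r) (p₃ + r)) := by
  rw [← ball_prod_same, ← ball_prod_same, Real.ball_eq_Ioo, Real.ball_eq_Ioo, Real.ball_eq_Ioo]

/-- Closed balls of `ℝ × ℝ × ℝ` (sup metric) are closed boxes. [folklore] -/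
theorem regValue_closedBall_eq (p₁ p₂ p₃ r : ℝ) :
    closedBall ((p₁, p₂, p₃) : ℝ × ℝ × ℝ) r =
      Icc (p₁ - r) (p₁ + r) ×ˢ (Icc (p₂ - r) (p₂ + r) ×ˢ Icc (p₃ - r) (p₃ + r)) := by
  rw [← closedBall_prod_same, ← closedBall_prod_same, Real.closedBall_eq_Icc,
    Real.closedBall_eq_Icc, Real.closedBall_eq_Icc]

/-- Sign flip: the local statement for the direction `v` follows from its positive-sign version,
provided the density property `D` is stable under `Ω ↦ -Ω`. [folklore] -/
theorem regValue_local_of_pos {D : (ℝ × ℝ × ℝ → ℝ) → (ℝ × ℝ × ℝ → ℝ) → Prop} {v : ℝ × ℝ × ℝ}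
    (hD : ∀ Ω G, ContDiff ℝ 1 Ω → D (fun q => -Ω q) G → D Ω G)
    (hv : ∀ (Ω : ℝ × ℝ × ℝ → ℝ) (p : ℝ × ℝ × ℝ), ContDiff ℝ 1 Ω → 0 < fderiv ℝ Ω p v →
      ∃ r > 0, ∀ G : ℝ × ℝ × ℝ → ℝ, Continuous G → (∀ q, 0 ≤ G q) → tsupport G ⊆ ball p r →
        D Ω G)
    {Ω : ℝ × ℝ × ℝ → ℝ} (hΩ : ContDiff ℝ 1 Ω) {p : ℝ × ℝ × ℝ} (hp : fderiv ℝ Ω p v ≠ 0) :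
    ∃ r > 0, ∀ G : ℝ × ℝ × ℝ → ℝ, Continuous G → (∀ q, 0 ≤ G q) → tsupport G ⊆ ball p r →
      D Ω G := by
  rcases Ne.lt_or_gt hp with h | h
  · have h' : 0 < fderiv ℝ (fun q => -Ω q) p v := by
      rw [fderiv_fun_neg, neg_apply]; linarith
    obtain ⟨r, hr0, hr⟩ := hv _ p hΩ.neg h'
    exact ⟨r, hr0, fun G hG hG0 hs => hD Ω G hΩ (hr G hG hG0 hs)⟩
  · exact hv Ω p hΩ h

/-- Change of coordinates: the local statement for the direction `w = e v` follows from the one for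
the direction `v`, for an involutive isometric linear automorphism `e` under which the density
property `D` is stable. [folklore] -/
theorem regValue_local_of_equiv {D : (ℝ × ℝ × ℝ → ℝ) → (ℝ × ℝ × ℝ → ℝ) → Prop}
    {v w : ℝ × ℝ × ℝ} (e : (ℝ × ℝ × ℝ) ≃L[ℝ] (ℝ × ℝ × ℝ)) (hinv : ∀ q, e (e q) = q)
    (hiso : ∀ a b, dist (e a) (e b) = dist a b) (hw : e v = w)
    (hD : ∀ Ω G, ContDiff ℝ 1 Ω → D (Ω ∘ e) (G ∘ e) → D Ω G)
    (hv : ∀ (Ω : ℝ × ℝ × ℝ → ℝ) (p : ℝ × ℝ × ℝ), ContDiff ℝ 1 Ω → fderiv ℝ Ω p v ≠ 0 →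
      ∃ r > 0, ∀ G : ℝ × ℝ × ℝ → ℝ, Continuous G → (∀ q, 0 ≤ G q) → tsupport G ⊆ ball p r →
        D Ω G)
    {Ω : ℝ × ℝ × ℝ → ℝ} (hΩ : ContDiff ℝ 1 Ω) {p : ℝ × ℝ × ℝ} (hp : fderiv ℝ Ω p w ≠ 0) :
    ∃ r > 0, ∀ G : ℝ × ℝ × ℝ → ℝ, Continuous G → (∀ q, 0 ≤ G q) → tsupport G ⊆ ball p r →
      D Ω G := by
  have hΩe : ContDiff ℝ 1 (Ω ∘ e) := hΩ.comp e.contDiff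
  have hpe : fderiv ℝ (Ω ∘ e) (e p) v ≠ 0 := by
    rwa [e.comp_right_fderiv, ContinuousLinearMap.comp_apply, ContinuousLinearEquiv.coe_coe,
      hinv, hw]
  obtain ⟨r, hr0, hr⟩ := hv _ _ hΩe hpe
  refine ⟨r, hr0, fun G hG hG0 hsupp =>
    hD Ω G hΩ (hr _ (hG.comp e.continuous) (fun q => hG0 _) ?_)⟩
  refine (tsupport_comp_subset_preimage G e.continuous).trans fun q hq => ?_
  have hq' : e q ∈ ball p r := hsupp hq
  rw [mem_ball] at hq' ⊢
  calc dist q (e p) = dist (e q) (e (e p)) := (hiso _ _).symm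
    _ = dist (e q) p := by rw [hinv]
    _ < r := hq'

/-- **Localisation.** Under the single-box hypothesis `REG-loc`, every point `p` with `dΩ(p) ≠ 0`
has a ball such that every continuous weight `G ≥ 0` supported in it has a continuous global
density `≥ 0` for the push-forward `Ω_* (G · vol)`. [folklore] -/
theorem regValue_local
    (hLoc : ∀ (Ω G : ℝ × ℝ × ℝ → ℝ) (a₁ b₁ a₂ b₂ a₃ b₃ c : ℝ), 0 < c → ContDiff ℝ 1 Ω →
      Continuous G → (∀ p, 0 ≤ G p) →
      tsupport G ⊆ Set.Ioo a₁ b₁ ×ˢ (Set.Ioo a₂ b₂ ×ˢ Set.Ioo a₃ b₃) →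
      (∀ p ∈ Set.Icc a₁ b₁ ×ˢ (Set.Icc a₂ b₂ ×ˢ Set.Icc a₃ b₃), c ≤ fderiv ℝ Ω p (1, 0, 0)) →
      ∃ ρ : ℝ → ℝ, Continuous ρ ∧ (∀ x, 0 ≤ ρ x) ∧
        MeasureTheory.Measure.map Ω (volume.withDensity fun p => ENNReal.ofReal (G p)) =
          volume.withDensity fun x => ENNReal.ofReal (ρ x))
    {Ω : ℝ × ℝ × ℝ → ℝ} (hΩ : ContDiff ℝ 1 Ω) {p : ℝ × ℝ × ℝ} (hp : fderiv ℝ Ω p ≠ 0) :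
    ∃ r > 0, ∀ G : ℝ × ℝ × ℝ → ℝ, Continuous G → (∀ q, 0 ≤ G q) → tsupport G ⊆ ball p r →
      ∃ ρ : ℝ → ℝ, Continuous ρ ∧ (∀ x, 0 ≤ ρ x) ∧
        Measure.map Ω (volume.withDensity fun q => ENNReal.ofReal (G q)) =
          volume.withDensity fun x => ENNReal.ofReal (ρ x) := by
  let D : (ℝ × ℝ × ℝ → ℝ) → (ℝ × ℝ × ℝ → ℝ) → Prop := fun Ω G =>
    ∃ ρ : ℝ → ℝ, Continuous ρ ∧ (∀ x, 0 ≤ ρ x) ∧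
      Measure.map Ω (volume.withDensity fun q => ENNReal.ofReal (G q)) =
        volume.withDensity fun x => ENNReal.ofReal (ρ x)
  -- direction `(1,0,0)`, positive sign: the hypothesis on a small closed ball (= closed box)
  have h0 : ∀ (Ω : ℝ × ℝ × ℝ → ℝ) (p : ℝ × ℝ × ℝ), ContDiff ℝ 1 Ω →
      0 < fderiv ℝ Ω p (1, 0, 0) → ∃ r > 0, ∀ G : ℝ × ℝ × ℝ → ℝ, Continuous G →
        (∀ q, 0 ≤ G q) → tsupport G ⊆ ball p r → D Ω G := by
    intro Ω p hΩ hp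
    have hcont : Continuous fun q => fderiv ℝ Ω q (1, 0, 0) :=
      (hΩ.continuous_fderiv one_ne_zero).clm_apply continuous_const
    obtain ⟨r, hr0, hr⟩ := regValue_ball_lower_bound hcont hp
    refine ⟨r, hr0, fun G hG hG0 hsupp => ?_⟩
    obtain ⟨p₁, p₂, p₃⟩ := p
    exact hLoc Ω G (p₁ - r) (p₁ + r) (p₂ - r) (p₂ + r) (p₃ - r) (p₃ + r) _ (half_pos hp) hΩ hG
      hG0 (by rwa [← regValue_ball_eq]) (fun q hq => hr q (by rwa [regValue_closedBall_eq]))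
  -- direction `(1,0,0)`, any sign
  have hDn : ∀ Ω G, ContDiff ℝ 1 Ω → D (fun q => -Ω q) G → D Ω G :=
    fun _ _ hΩ h => regValue_hasDensity_of_neg hΩ.continuous.measurable h
  have h1 : ∀ (Ω : ℝ × ℝ × ℝ → ℝ) (p : ℝ × ℝ × ℝ), ContDiff ℝ 1 Ω →
      fderiv ℝ Ω p (1, 0, 0) ≠ 0 → ∃ r > 0, ∀ G : ℝ × ℝ × ℝ → ℝ, Continuous G →
        (∀ q, 0 ≤ G q) → tsupport G ⊆ ball p r → D Ω G :=
    fun _ _ hΩ hp => regValue_local_of_pos (D := D) (v := (1, 0, 0)) hDn h0 hΩ hp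
  -- the coordinate swaps `(x, y, z) ↦ (y, x, z)` and `(x, y, z) ↦ (x, z, y)` as continuous linear
  -- automorphisms (involutive isometries preserving Lebesgue measure)
  obtain ⟨e₁₂, he₁₂⟩ : ∃ e : (ℝ × ℝ × ℝ) ≃L[ℝ] (ℝ × ℝ × ℝ), ∀ q, e q = (q.2.1, q.1, q.2.2) :=
    ⟨{ toFun := fun q => (q.2.1, q.1, q.2.2), invFun := fun q => (q.2.1, q.1, q.2.2),
       map_add' := fun _ _ => rfl, map_smul' := fun _ _ => rfl, left_inv := fun _ => rfl,
       right_inv := fun _ => rfl, continuous_toFun := by fun_prop,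
       continuous_invFun := by fun_prop }, fun _ => rfl⟩
  obtain ⟨e₂₃, he₂₃⟩ : ∃ e : (ℝ × ℝ × ℝ) ≃L[ℝ] (ℝ × ℝ × ℝ), ∀ q, e q = (q.1, q.2.2, q.2.1) :=
    ⟨{ toFun := fun q => (q.1, q.2.2, q.2.1), invFun := fun q => (q.1, q.2.2, q.2.1),
       map_add' := fun _ _ => rfl, map_smul' := fun _ _ => rfl, left_inv := fun _ => rfl,
       right_inv := fun _ => rfl, continuous_toFun := by fun_prop,
       continuous_invFun := by fun_prop }, fun _ => rfl⟩
  have hf₁₂ : (e₁₂ : ℝ × ℝ × ℝ → ℝ × ℝ × ℝ) = fun q => (q.2.1, q.1, q.2.2) := funext he₁₂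
  have hf₂₃ : (e₂₃ : ℝ × ℝ × ℝ → ℝ × ℝ × ℝ) = fun q => (q.1, q.2.2, q.2.1) := funext he₂₃
  have hmp₁₂ : MeasurePreserving e₁₂ volume volume := by
    rw [hf₁₂]; exact regValue_measurePreserving_swap12
  have hmp₂₃ : MeasurePreserving e₂₃ volume volume := by
    rw [hf₂₃]; exact regValue_measurePreserving_swap23
  -- direction `(0,1,0)`: swap the first two coordinates
  have h2 : ∀ (Ω : ℝ × ℝ × ℝ → ℝ) (p : ℝ × ℝ × ℝ), ContDiff ℝ 1 Ω →
      fderiv ℝ Ω p (0, 1, 0) ≠ 0 → ∃ r > 0, ∀ G : ℝ × ℝ × ℝ → ℝ, Continuous G →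
        (∀ q, 0 ≤ G q) → tsupport G ⊆ ball p r → D Ω G :=
    fun _ _ hΩ hp => regValue_local_of_equiv (D := D) (v := (1, 0, 0)) (w := (0, 1, 0)) e₁₂
      (fun q => by simp [he₁₂]) (fun a b => by simp only [he₁₂, Prod.dist_eq, max_left_comm])
      (by simp [he₁₂]) (fun _ _ hΩ h => regValue_hasDensity_of_equiv e₁₂ hmp₁₂
        hΩ.continuous.measurable h) h1 hΩ hp
  -- direction `(0,0,1)`: swap the last two coordinates and use the previous case
  have h3 : ∀ (Ω : ℝ × ℝ × ℝ → ℝ) (p : ℝ × ℝ × ℝ), ContDiff ℝ 1 Ω →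
      fderiv ℝ Ω p (0, 0, 1) ≠ 0 → ∃ r > 0, ∀ G : ℝ × ℝ × ℝ → ℝ, Continuous G →
        (∀ q, 0 ≤ G q) → tsupport G ⊆ ball p r → D Ω G :=
    fun _ _ hΩ hp => regValue_local_of_equiv (D := D) (v := (0, 1, 0)) (w := (0, 0, 1)) e₂₃
      (fun q => by simp [he₂₃]) (fun a b => by simp only [he₂₃, Prod.dist_eq, max_comm])
      (by simp [he₂₃]) (fun _ _ hΩ h => regValue_hasDensity_of_equiv e₂₃ hmp₂₃
        hΩ.continuous.measurable h) h2 hΩ hp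
  rcases regValue_exists_dir hp with h | h | h
  exacts [h1 Ω p hΩ h, h2 Ω p hΩ h, h3 Ω p hΩ h]

/-! ### Summation -/

/-- Assembly of finitely many global densities into a density on a window `W`: if `G = Σᵢ Gᵢ` on
`Ω⁻¹(W)` and each `Ω_* (Gᵢ · vol)` has density `ρᵢ`, then `Ω_* (G · vol)` has density `Σᵢ ρᵢ`
on `W`. [folklore] -/
theorem regValue_restrict_map_eq_sum {ι : Type*} [Fintype ι] {Ω G : ℝ × ℝ × ℝ → ℝ}
    {W : Set ℝ} (hW : MeasurableSet W) (hΩ : Measurable Ω) (Gi : ι → (ℝ × ℝ × ℝ) → ℝ)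
    (ρi : ι → ℝ → ℝ) (hGi : ∀ i, Measurable (Gi i)) (hGi0 : ∀ i q, 0 ≤ Gi i q)
    (hρi : ∀ i, Measurable (ρi i)) (hρi0 : ∀ i x, 0 ≤ ρi i x)
    (hsum : ∀ q, Ω q ∈ W → G q = ∑ i, Gi i q)
    (heq : ∀ i, Measure.map Ω (volume.withDensity fun q => ENNReal.ofReal (Gi i q)) =
      volume.withDensity fun x => ENNReal.ofReal (ρi i x)) :
    (Measure.map Ω (volume.withDensity fun q => ENNReal.ofReal (G q))).restrict W =
      (volume.restrict W).withDensity fun x => ENNReal.ofReal (∑ i, ρi i x) := by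
  ext s hs
  have hsW : MeasurableSet (Ω ⁻¹' (s ∩ W)) := hΩ (hs.inter hW)
  rw [Measure.restrict_apply hs, Measure.map_apply hΩ (hs.inter hW), withDensity_apply _ hsW,
    withDensity_apply _ hs, Measure.restrict_restrict hs]
  have h1 : ∫⁻ q in Ω ⁻¹' (s ∩ W), ENNReal.ofReal (G q) =
      ∫⁻ q in Ω ⁻¹' (s ∩ W), ∑ i, ENNReal.ofReal (Gi i q) := by
    refine setLIntegral_congr_fun hsW fun q hq => ?_
    rw [hsum q hq.2, ENNReal.ofReal_sum_of_nonneg fun i _ => hGi0 i q]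
  have h2 : ∀ i, ∫⁻ q in Ω ⁻¹' (s ∩ W), ENNReal.ofReal (Gi i q) =
      ∫⁻ x in s ∩ W, ENNReal.ofReal (ρi i x) := by
    intro i
    have h := DFunLike.congr_fun (heq i) (s ∩ W)
    rwa [Measure.map_apply hΩ (hs.inter hW), withDensity_apply _ hsW,
      withDensity_apply _ (hs.inter hW)] at h
  rw [h1, lintegral_finsetSum _ fun i _ => (hGi i).ennreal_ofReal]
  simp_rw [h2]
  rw [← lintegral_finsetSum _ fun i _ => (hρi i).ennreal_ofReal]
  refine lintegral_congr fun x => ?_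
  rw [ENNReal.ofReal_sum_of_nonneg fun i _ => hρi0 i x]

/-! ### The stub -/

/-- **Regular-value density** (stub REG of line `swap-odd-threshold-rigidity`, shape
`REG-loc → REG`). Assuming the single-box monotone-fibre density statement `REG-loc`, a `C¹`
function `Ω` on `ℝ × ℝ × ℝ` and a compactly supported continuous weight `G ≥ 0` with `dΩ ≠ 0` on
`tsupport G ∩ {|Ω| ≤ δ₀}` admit a continuous density `ρ ≥ 0` on the window `(-δ₀, δ₀)` for the
push-forward `Ω_* (G · vol)`. [folklore] -/
theorem stub_regularValueDensity :
    (∀ (Ω G : ℝ × ℝ × ℝ → ℝ) (a₁ b₁ a₂ b₂ a₃ b₃ c : ℝ), 0 < c → ContDiff ℝ 1 Ω → Continuous G →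
      (∀ p, 0 ≤ G p) →
      tsupport G ⊆ Set.Ioo a₁ b₁ ×ˢ (Set.Ioo a₂ b₂ ×ˢ Set.Ioo a₃ b₃) →
      (∀ p ∈ Set.Icc a₁ b₁ ×ˢ (Set.Icc a₂ b₂ ×ˢ Set.Icc a₃ b₃), c ≤ fderiv ℝ Ω p (1, 0, 0)) →
      ∃ ρ : ℝ → ℝ, Continuous ρ ∧ (∀ x, 0 ≤ ρ x) ∧
        MeasureTheory.Measure.map Ω (volume.withDensity fun p => ENNReal.ofReal (G p)) =
          volume.withDensity fun x => ENNReal.ofReal (ρ x)) →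
    ∀ (Ω G : ℝ × ℝ × ℝ → ℝ) (δ₀ : ℝ), 0 < δ₀ → ContDiff ℝ 1 Ω → Continuous G → HasCompactSupport G →
      (∀ p, 0 ≤ G p) →
      (∀ p ∈ tsupport G, |Ω p| ≤ δ₀ → fderiv ℝ Ω p ≠ 0) →
      ∃ ρ : ℝ → ℝ, ContinuousOn ρ (Set.Ioo (-δ₀) δ₀) ∧ (∀ x ∈ Set.Ioo (-δ₀) δ₀, 0 ≤ ρ x) ∧
        (MeasureTheory.Measure.map Ω (volume.withDensity fun p => ENNReal.ofReal (G p))).restrict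
            (Set.Ioo (-δ₀) δ₀) =
          (volume.restrict (Set.Ioo (-δ₀) δ₀)).withDensity fun x => ENNReal.ofReal (ρ x) := by
  intro hLoc Ω G δ₀ _ hΩ hG hGc hG0 hreg
  -- the compact set `K = tsupport G ∩ Ω⁻¹[-δ₀, δ₀]` and the local radii
  have hKc : IsCompact (tsupport G ∩ Ω ⁻¹' Icc (-δ₀) δ₀) :=
    hGc.isCompact.inter_right (isClosed_Icc.preimage hΩ.continuous)
  choose! r hr0 hr using fun (p : ℝ × ℝ × ℝ) (hp : p ∈ tsupport G ∩ Ω ⁻¹' Icc (-δ₀) δ₀) =>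
    regValue_local hLoc hΩ (hreg p hp.1 (abs_le.mpr hp.2))
  obtain ⟨t, htK, hcover⟩ := hKc.elim_nhds_subcover (fun p => ball p (r p))
    fun p hp => ball_mem_nhds p (hr0 p hp)
  -- reindex the finite cover by `Fin n` and take a subordinate partition of unity
  have hcK : ∀ i : Fin t.card, ((t.equivFin.symm i : t) : ℝ × ℝ × ℝ) ∈
      tsupport G ∩ Ω ⁻¹' Icc (-δ₀) δ₀ := fun i => htK _ (t.equivFin.symm i).2
  have hcover' : tsupport G ∩ Ω ⁻¹' Icc (-δ₀) δ₀ ⊆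
      ⋃ i : Fin t.card, ball ((t.equivFin.symm i : t) : ℝ × ℝ × ℝ) (r (t.equivFin.symm i)) := by
    intro x hx
    obtain ⟨p, hp, hxp⟩ := mem_iUnion₂.mp (hcover hx)
    refine mem_iUnion.mpr ⟨t.equivFin ⟨p, hp⟩, ?_⟩
    simpa using hxp
  obtain ⟨χ, hχsupp, hχsum, hχ01, -⟩ :=
    exists_continuous_sum_one_of_isOpen_isCompact (fun _ => isOpen_ball) hKc hcover'
  -- continuous global densities `ρ i` of the localised pieces `χ i * G`
  choose ρ hρc hρ0 hρeq using fun i : Fin t.card => hr _ (hcK i) (fun q => χ i q * G q)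
    ((χ i).continuous.mul hG) (fun q => mul_nonneg (hχ01 i q).1 (hG0 q))
    (tsupport_mul_subset_left.trans (hχsupp i))
  refine ⟨fun x => ∑ i, ρ i x, (continuous_finsetSum _ fun i _ => hρc i).continuousOn,
    fun x _ => Finset.sum_nonneg fun i _ => hρ0 i x, ?_⟩
  -- on `Ω⁻¹(-δ₀, δ₀)` the pieces add up to `G`
  have hsum : ∀ q, Ω q ∈ Ioo (-δ₀) δ₀ → G q = ∑ i, χ i q * G q := by
    intro q hq
    by_cases hqs : q ∈ tsupport G
    · have h1 := hχsum ⟨hqs, Ioo_subset_Icc_self hq⟩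
      simp only [Finset.sum_apply, Pi.one_apply] at h1
      rw [← Finset.sum_mul, h1, one_mul]
    · simp [image_eq_zero_of_notMem_tsupport hqs]
  exact regValue_restrict_map_eq_sum measurableSet_Ioo hΩ.continuous.measurable
    (fun i q => χ i q * G q) ρ (fun i => ((χ i).continuous.mul hG).measurable)
    (fun i q => mul_nonneg (hχ01 i q).1 (hG0 q)) (fun i => (hρc i).measurable) hρ0 hsum hρeq

end Summit.AtomisticToContinuum.FouriersLaw.Theorems.MourreDissolution
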